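import Summits.CriticalPhenomena.PercolationContinuityZ3.Theorems.PercNearOneGluingNoHeavyLowerTailCertRowsPat
import Summits.CriticalPhenomena.PercolationContinuityZ3.Theorems.PercNearOneGluingNoHeavyLowerTailCertRowsH
import Literature.Probability.Percolation.ClusterConditionedBK
import Literature.Probability.Percolation.TwoSetExchange
import HarnessLib

/-!
# `NoHeavyLowerTail` (stmt-CriticalPhenomena-4575) — certificate rows VIII: CLUSTER-CONDITIONED BK / REIMER rows (`ccbk`)

Support file (prover prim-ineq-prove-1, new-inequality factory; `--supports stmt-CriticalPhenomena-4575`).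

The `ccbk` rows of the `(U_min)_3` certificate searches (ttrl wf3lp `rows_ccbk`; prim-lf-1): for disjoint terminal sets `S, T`,
`D = {S ↮ T}`, `A` = a conjunction of connection literals `s ~ u` with `s ∈ S` (increasing in the union of the open edge clusters of
`S`), `B` = a conjunction of literals each touching a terminal of `T` (determined by the open edge clusters of `T`), `Q` = a
conjunction of separation literals (decreasing):
      `μ[⊤] · μ(A ∧ B ∧ Q ∧ D) ≤ μ(A) · μ(B ∧ Q ∧ D)`
— the tree's cluster-conditioned BK inequality `Literature.Probability.Percolation.clusterConditionedBK_block` (van den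
Berg–Häggström–Kahn 2006 Thm. 1.1 / Reimer) read on pattern formulas.  `RowSpecCC` carries the data, `RowSpecCC.valid` decides
the side conditions, `RowSpecCC.toRow` is the checker row and `RowSpecCC.holds` its validity at the cell law of every weighted
graph and placement.
No named facts, no sorries, standard axioms.
[cite: VandenbergHaggstromKahn2005, Thm. 1.1; Reimer2000, Thm. (BK–Reimer)]
-/

noncomputable section

namespace Summit.CriticalPhenomena.PercolationContinuityZ3.Theorems

open MeasureTheory Set Literature.Probability.Percolation
open Literature.Probability.LatticeModels (prodBernoulli)
open scoped Classical BigOperators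
open PatternCells CertCheck CertCells PatternSunflower

namespace CertCells

variable {n : ℕ}

/-- The separation literals `s ≁ t`, `s ∈ S`, `t ∈ T` (the event `D = {S ↮ T}`). [folklore] -/
def litsBlockSep (S T : List (Fin 5)) : List Lit := S.flatMap fun s => litsSep s T

/-- A cluster-conditioned BK row: `μ[⊤]·μ(A ∧ B ∧ Q ∧ D) ≤ μ(A)·μ(B ∧ Q ∧ D)`. [cite: VandenbergHaggstromKahn2005, Thm. 1.1] -/
structure RowSpecCC where
  /-- source terminals `S` -/
  S : List (Fin 5)
  /-- target terminals `T` -/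
  T : List (Fin 5)
  /-- `A`: connection literals `(s, u)` meaning `s ~ u`, `s ∈ S` -/
  Al : List (Fin 5 × Fin 5)
  /-- `B`: literals each touching `T` -/
  Bl : List Lit
  /-- `Q`: separation literals -/
  Ql : List Lit
  /-- monomial multiplier -/
  mult : List ℕ
  /-- weight -/
  wt : ℕ

/-- Side conditions (decidable): `A`-literals start in `S`, `B`-literals touch `T`, `Q`-literals are separations. [folklore] -/
def RowSpecCC.valid (r : RowSpecCC) : Bool :=
  (r.Al.all fun p => decide (p.1 ∈ r.S)) && (r.Bl.all fun l => decide (l.1 ∈ r.T) || decide (l.2.1 ∈ r.T)) &&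
    r.Ql.all fun l => l.2.2 == false

/-- The clause of `A`. [folklore] -/
def RowSpecCC.clA (r : RowSpecCC) : List Lit := litsPairs r.Al true

/-- The clause of `B ∧ Q ∧ D`. [folklore] -/
def RowSpecCC.clBQD (r : RowSpecCC) : List Lit := r.Bl ++ r.Ql ++ litsBlockSep r.S r.T

/-- The checker row `⟨⊤, A∧B∧Q∧D, A, B∧Q∧D⟩`. [folklore] -/
def RowSpecCC.toRow (r : RowSpecCC) : Row :=
  ⟨cellsOf [[]], cellsOf [r.clA ++ r.clBQD], cellsOf [r.clA], cellsOf [r.clBQD], r.mult, r.wt⟩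

/-- The block separation clause denotes `{S ↮ T}` for the placed terminals. [folklore] -/
theorem set_litsBlockSep (v : Fin 5 → Fin n) (S T : List (Fin 5)) :
    Formula.set v [litsBlockSep S T] =
      {ω : BondConfig (Fin n) | ∀ s ∈ ((S.map v).toFinset : Set (Fin n)), ∀ t ∈ ((T.map v).toFinset : Set (Fin n)),
        ¬ (openGraph ω).Reachable s t} := by
  ext ω
  simp only [mem_set_single, litsBlockSep, List.mem_flatMap, Set.mem_setOf_eq, Finset.mem_coe, List.mem_toFinset, List.mem_map]
  constructor
  · rintro h _ ⟨s, hs, rfl⟩ _ ⟨t, ht, rfl⟩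
    have := h (s, t, false) ⟨s, hs, by simp [litsSep, ht]⟩
    simpa [Lit.holds] using this
  · rintro h l ⟨s, hs, hl⟩
    simp only [litsSep, List.mem_map] at hl
    obtain ⟨t, ht, rfl⟩ := hl
    have := h (v s) ⟨s, hs, rfl⟩ (v t) ⟨t, ht, rfl⟩
    simpa [Lit.holds] using this

/-- A conjunction of separation literals is a decreasing event. [folklore] -/
theorem isLowerSet_set_of_seps (v : Fin 5 → Fin n) (Ql : List Lit) (hQ : (Ql.all fun l => l.2.2 == false) = true) :
    IsLowerSet (Formula.set v [Ql]) := by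
  intro ω ω' hle hω
  rw [mem_set_single] at hω ⊢
  intro l hl
  have hb : l.2.2 = false := by
    rw [List.all_eq_true] at hQ
    simpa using hQ l hl
  have h := hω l hl
  unfold Lit.holds at h ⊢
  rw [hb] at h ⊢
  simp only [Bool.false_eq_true, iff_false] at h ⊢
  exact fun hr => h (hr.mono (openGraph_mono hle))

/-- Reachability from `t` is determined by the open edge cluster of `t`. [folklore] -/
theorem reachable_iff_of_openEdgeCluster_eq {ω ω' : BondConfig (Fin n)} {t : Fin n}
    (heq : openEdgeCluster ω' t = openEdgeCluster ω t) (u : Fin n) :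
    (openGraph ω').Reachable t u ↔ (openGraph ω).Reachable t u := by
  rw [reachable_iff_exists_mem_openEdgeCluster, reachable_iff_exists_mem_openEdgeCluster, heq]

/-- **A valid cluster-conditioned BK row holds at every cell law.** [cite: VandenbergHaggstromKahn2005, Thm. 1.1] -/
theorem RowSpecCC.holds (r : RowSpecCC) (hr : r.valid = true) (w : Sym2 (Fin n) → unitInterval) (v : Fin 5 → Fin n) :
    let x : ℕ → ℝ := fun m => (prodBernoulli w).real (Cell v m)
    linEval x r.toRow.e1 * linEval x r.toRow.e2 ≤ linEval x r.toRow.e3 * linEval x r.toRow.e4 := by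
  intro x
  haveI : IsProbabilityMeasure (prodBernoulli w) := inferInstance
  simp only [RowSpecCC.valid, Bool.and_eq_true, List.all_eq_true, Bool.or_eq_true, decide_eq_true_eq] at hr
  obtain ⟨⟨hAl, hBl⟩, hQl⟩ := hr
  simp only [RowSpecCC.toRow, x, ← measureReal_set_eq_linEval]
  rw [set_nilClause, probReal_univ, one_mul]
  -- the four events
  set SA : Set (BondConfig (Fin n)) := Formula.set v [r.clA] with hSA
  set SB : Set (BondConfig (Fin n)) := Formula.set v [r.Bl] with hSB
  set SQ : Set (BondConfig (Fin n)) := Formula.set v [r.Ql] with hSQ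
  set Sset : Set (Fin n) := ((r.S.map v).toFinset : Set (Fin n)) with hSset
  set Tset : Set (Fin n) := ((r.T.map v).toFinset : Set (Fin n)) with hTset
  set SD : Set (BondConfig (Fin n)) := {ω | ∀ s ∈ Sset, ∀ t ∈ Tset, ¬ (openGraph ω).Reachable s t} with hSD
  have eBQD : Formula.set v [r.clBQD] = SB ∩ SQ ∩ SD := by
    rw [RowSpecCC.clBQD, set_single_append, set_single_append, set_litsBlockSep, Set.inter_assoc]
  have eABQD : Formula.set v [r.clA ++ r.clBQD] = SA ∩ SB ∩ SQ ∩ SD := by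
    rw [set_single_append, eBQD, ← Set.inter_assoc, ← Set.inter_assoc]
  rw [eABQD, eBQD]
  have hQll : (r.Ql.all fun l => l.2.2 == false) = true := by
    rw [List.all_eq_true]; intro l hl; simpa using hQl l hl
  refine clusterConditionedBK_block w Sset Tset (A := SA) (B := SB) (Q := SQ) ?_ ?_ (isLowerSet_set_of_seps v r.Ql hQll)
  · -- `A` is increasing in the union of the open edge clusters of `S`
    intro ω ω' hω hsub
    rw [hSA, mem_set_single] at hω ⊢
    intro l hl
    simp only [RowSpecCC.clA, litsPairs, List.mem_map] at hl
    obtain ⟨p, hp, rfl⟩ := hl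
    have hpl := hω (p.1, p.2, true) (by simp only [RowSpecCC.clA, litsPairs, List.mem_map]; exact ⟨p, hp, rfl⟩)
    simp only [Lit.holds, iff_true] at hpl ⊢
    have hs : v p.1 ∈ Sset := by
      rw [hSset, Finset.mem_coe, List.mem_toFinset, List.mem_map]
      exact ⟨p.1, hAl p hp, rfl⟩
    -- the edge cluster of `v p.1` in `ω` stays open in `ω'`, hence is contained in its cluster in `ω'`
    have hCsub : openEdgeCluster ω (v p.1) ⊆ ω' := by
      intro e he
      have he' : e ∈ ⋃ s ∈ Sset, openEdgeCluster ω' s := hsub (Set.mem_iUnion₂.2 ⟨v p.1, hs, he⟩)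
      obtain ⟨s', _, hes'⟩ := Set.mem_iUnion₂.1 he'
      exact openEdgeCluster_subset ω' s' hes'
    have hCC := TwoSetExchange.openEdgeCluster_subset_of_subset hCsub
    rcases (reachable_iff_exists_mem_openEdgeCluster ω (v p.1) (v p.2)).1 hpl with h | ⟨e, he, hue⟩
    · rw [h]
    · exact (reachable_iff_exists_mem_openEdgeCluster ω' (v p.1) (v p.2)).2 (Or.inr ⟨e, hCC he, hue⟩)
  · -- `B` is determined by the open edge clusters of `T`
    intro ω ω' hω heq
    rw [hSB, mem_set_single] at hω ⊢
    intro l hl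
    have h := hω l hl
    rcases hBl l hl with ht | ht
    · have hvt : v l.1 ∈ Tset := by
        rw [hTset, Finset.mem_coe, List.mem_toFinset, List.mem_map]; exact ⟨l.1, ht, rfl⟩
      unfold Lit.holds at h ⊢
      rw [reachable_iff_of_openEdgeCluster_eq (heq _ hvt)]
      exact h
    · have hvt : v l.2.1 ∈ Tset := by
        rw [hTset, Finset.mem_coe, List.mem_toFinset, List.mem_map]; exact ⟨l.2.1, ht, rfl⟩
      unfold Lit.holds at h ⊢
      have hsym : ∀ ω'' : BondConfig (Fin n), (openGraph ω'').Reachable (v l.1) (v l.2.1) ↔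
          (openGraph ω'').Reachable (v l.2.1) (v l.1) := fun ω'' => ⟨SimpleGraph.Reachable.symm, SimpleGraph.Reachable.symm⟩
      rw [hsym, reachable_iff_of_openEdgeCluster_eq (heq _ hvt), ← hsym]
      exact h

/-- Valid cluster-conditioned BK rows hold, list form. [folklore] -/
theorem RowSpecCC.holds_all (rows : List RowSpecCC) (hvalid : rows.all RowSpecCC.valid = true)
    (w : Sym2 (Fin n) → unitInterval) (v : Fin 5 → Fin n) :
    ∀ r ∈ rows.map RowSpecCC.toRow,
      linEval (fun m => (prodBernoulli w).real (Cell v m)) r.e1 * linEval (fun m => (prodBernoulli w).real (Cell v m)) r.e2 ≤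
        linEval (fun m => (prodBernoulli w).real (Cell v m)) r.e3 * linEval (fun m => (prodBernoulli w).real (Cell v m)) r.e4 := by
  intro r hr
  obtain ⟨s, hs, rfl⟩ := List.mem_map.1 hr
  rw [List.all_eq_true] at hvalid
  exact RowSpecCC.holds s (hvalid s hs) w v

end CertCells

end Summit.CriticalPhenomena.PercolationContinuityZ3.Theorems

end
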